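import Summits.BirchSwinnertonDyer.BirchSwinnertonDyer.Theorems.ResidualThetaTransportAtTwoThetaLayerLambdaCongruenceAtTwoDepletedHecke
import Literature.NumberTheory.EllipticCurves.PAdicLFunctionProofs
import HarnessLib

/-!
# Crux `ThetaLayerLambdaCongruenceAtTwo` (stmt-BirchSwinnertonDyer-20688, route ResidualThetaTransportAtTwo), line
# `birth`: the CURVE's `S₀`-depleted plus symbol is full-Hecke eigen — `T_q ↦ a_q(W)` off `S₀`, `U_ℓ ↦ 0` on `S₀`
# (width prover bsd-wall-rtt-p3-w2 g0; `--supports stmt-BirchSwinnertonDyer-20688 --as helper`; closes nothing)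

HONEST FRAMING. THEOREMS of the tree's definitions only; nothing about any curve or form is asserted beyond the
hypothesis `IsNewformOf W f`; BSD is not proved by any of this.

WHAT. Twin of `…DepletedHecke.lean` on the curve side: for the newform `f` of `W` (rational coefficients,
`IsNewformOf.coeffField_eq_bot`; plus period `Ω⁺_f`, `isPlusPeriod_plusPeriod`; `[r]⁺_{f,Ω⁺_f} = ratPlusSymbol f r`,
`plusSymbolK_plusPeriod_eq_algebraMap`; `a_q(f) = a_q(W) = W.LFunction q`), the `S₀`-depleted rational plus symbol
`φ^{S₀}_W(x) = ∑_{k : S₀ → {0,1,2}} (∏_v c_{v,k_v} ℓ_v^{−k_v}) · [x·∏_v ℓ_v^{k_v}]⁺_f`, with `c_{v,·}` the coefficients of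
`P^f_v = 1 − a_{ℓ_v}(W) X + 𝟙_{ℓ_v∤N} ℓ_v X²`, read in `ℚ̄₂`, satisfies
* `heckeT_depletedCurveSymbol`: `a_q(W)·φ^{S₀}_W(r) = ∑_{j<q} φ^{S₀}_W((r+j)/q) + 𝟙_{q∤N} φ^{S₀}_W(q r)` for primes `q ∉ ℓ(S₀)`;
* `heckeU_depletedCurveSymbol_eq_zero`: `∑_{j<ℓ} φ^{S₀}_W((r+j)/ℓ) = 0` for `ℓ = ℓ_{v₀}`, `v₀ ∈ S₀`.
(Instantiate the partner theorems at `(g, M, Ω, ι) = (f, N, Ω⁺_f, ι_f)` for the canonical `ι_f : K_f = ℚ → ℚ̄₂`.)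
NOTE. `P^f_v` equals the crux's `L_v(W, X)` (`W.localPolynomialAt v`: `1 − a_ℓ T + ℓT²` good, `1 ∓ T` multiplicative,
`1` additive, with `a_ℓ(W) = W.LFunction ℓ` in each case and `ℓ ∣ N_W` iff bad) — that four-case identification
(`localPolynomialAt_of_hasGoodReductionAt`, `…_of_hasSplitMultiplicativeReductionAt`, …, `dvd_conductorNorm_iff`,
`LFunction_apply_prime_…`) is left to a separate file; with it, together with `…DepletedHecke.lean` and the crux's
`hcong` (+ `a₂ = 0` on both sides), the depleted symbols of `W` and `g` are eigen for the full Hecke algebra of the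
depleted odd level with characters congruent modulo the maximal ideal of `ℚ̄₂` — the «same `𝔪'`» input of (H-sym).

References: [GreenbergVatsal2000] §1 (8), §3; [Vatsal1999] §1; [CremonaAlgorithms1997] §2.8; [MazurTateTeitelbaum1986Invent] §I.4, §I.8.
-/

noncomputable section

-- justification: the `Summit.BirchSwinnertonDyer.BirchSwinnertonDyer.…` path repeats a component (route-file convention)
set_option linter.dupNamespace false

open scoped Classical

open Polynomial

open Literature.NumberTheory.EllipticCurves Literature.NumberTheory.EllipticCurves.ModularForms

namespace Summit.BirchSwinnertonDyer.BirchSwinnertonDyer.Theorems.ThetaLayerLambdaCongruenceAtTwo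

section Curve

variable {N : ℕ} [NeZero N] {f : CuspForm (CongruenceSubgroup.Gamma0 N) 2}

/-- **A rational newform read `2`-adically.** For the newform `f` of `W` there is a ring map `ι_f : K_f → ℚ̄₂`
(`K_f = ℚ`) along which `[x]⁺_{f,Ω⁺_f}` reads as `ratPlusSymbol f x ∈ ℚ ⊆ ℚ̄₂` and `a_q(f)` as `W.LFunction q ∈ ℤ`.
[cite: MazurTateTeitelbaum1986Invent, §I.8] -/
theorem exists_embedding_of_isNewformOf {W : WeierstrassCurve ℚ} (hf : IsNewformOf W f) :
    ∃ ι : coeffField f →+* PadicAlgCl 2,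
      (∀ x : ℚ, ι (plusSymbolK f (plusPeriod f : ℂ) x) = algebraMap ℚ (PadicAlgCl 2) (ratPlusSymbol f x)) ∧
        ∀ q : ℕ, embCoeff f ι q = (W.LFunction q : PadicAlgCl 2) := by
  have hQ : coeffField f = ⊥ := hf.coeffField_eq_bot
  let ι : coeffField f →+* PadicAlgCl 2 :=
    (algebraMap ℚ (PadicAlgCl 2)).comp
      ((IntermediateField.botEquiv ℚ ℂ).toAlgHom.toRingHom.comp (IntermediateField.equivOfEq hQ).toAlgHom.toRingHom)
  refine ⟨ι, fun x ↦ ?_, fun q ↦ embCoeff_eq_intCast f ι (hf.2 q)⟩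
  rw [plusSymbolK_plusPeriod_eq_algebraMap hf.1 hQ, show algebraMap ℚ (coeffField f) (ratPlusSymbol f x) =
    ((ratPlusSymbol f x : ℚ) : coeffField f) from (eq_ratCast _ _), map_ratCast, eq_ratCast]

/-- **`T_q φ^{S₀}_W = a_q(W)·φ^{S₀}_W` off `S₀`** (relation form): for the newform `f` of `W`, any finite set `S₀` of
places and any prime `q ≠ ℓ_v` (`v ∈ S₀`), `a_q(W)·φ^{S₀}_W(r) = ∑_{j<q} φ^{S₀}_W((r+j)/q) + 𝟙_{q∤N} q·q⁻¹ φ^{S₀}_W(q r)`,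
`φ^{S₀}_W` the explicit depleted rational plus symbol with Euler polynomials `1 − a_ℓ(W)X + 𝟙_{ℓ∤N}ℓX²`.
[cite: GreenbergVatsal2000, §1 (8) and §3 (the Σ₀-depleted form is an eigenform for all T_q, q ∉ Σ₀)] -/
theorem heckeT_depletedCurveSymbol {W : WeierstrassCurve ℚ} (hf : IsNewformOf W f)
    (S₀ : Finset (IsDedekindDomain.HeightOneSpectrum (NumberField.RingOfIntegers ℚ))) {q : ℕ} (hq : q.Prime)
    (hqS : ∀ v ∈ S₀, Rat.HeightOneSpectrum.natGenerator v ≠ q) (r : ℚ) :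
    (W.LFunction q : PadicAlgCl 2) * (∑ k ∈ Fintype.piFinset (fun _ : S₀ ↦ Finset.range 3),
        (∏ v : S₀, (1 - C ((W.LFunction (Rat.HeightOneSpectrum.natGenerator (v : IsDedekindDomain.HeightOneSpectrum (NumberField.RingOfIntegers ℚ))) : PadicAlgCl 2)) * X + (if Rat.HeightOneSpectrum.natGenerator (v : IsDedekindDomain.HeightOneSpectrum (NumberField.RingOfIntegers ℚ)) ∣ N then 0 else C (Rat.HeightOneSpectrum.natGenerator (v : IsDedekindDomain.HeightOneSpectrum (NumberField.RingOfIntegers ℚ)) : PadicAlgCl 2)) * X ^ 2 : (PadicAlgCl 2)[X]).coeff (k v) *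
            ((Rat.HeightOneSpectrum.natGenerator (v : IsDedekindDomain.HeightOneSpectrum (NumberField.RingOfIntegers ℚ)) : PadicAlgCl 2)⁻¹) ^ (k v)) *
          algebraMap ℚ (PadicAlgCl 2) (ratPlusSymbol f (r * ((∏ v : S₀, Rat.HeightOneSpectrum.natGenerator (v : IsDedekindDomain.HeightOneSpectrum (NumberField.RingOfIntegers ℚ)) ^ (k v) : ℕ) : ℚ)))) =
      (∑ j : Fin q, ∑ k ∈ Fintype.piFinset (fun _ : S₀ ↦ Finset.range 3),
        (∏ v : S₀, (1 - C ((W.LFunction (Rat.HeightOneSpectrum.natGenerator (v : IsDedekindDomain.HeightOneSpectrum (NumberField.RingOfIntegers ℚ))) : PadicAlgCl 2)) * X + (if Rat.HeightOneSpectrum.natGenerator (v : IsDedekindDomain.HeightOneSpectrum (NumberField.RingOfIntegers ℚ)) ∣ N then 0 else C (Rat.HeightOneSpectrum.natGenerator (v : IsDedekindDomain.HeightOneSpectrum (NumberField.RingOfIntegers ℚ)) : PadicAlgCl 2)) * X ^ 2 : (PadicAlgCl 2)[X]).coeff (k v) *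
            ((Rat.HeightOneSpectrum.natGenerator (v : IsDedekindDomain.HeightOneSpectrum (NumberField.RingOfIntegers ℚ)) : PadicAlgCl 2)⁻¹) ^ (k v)) *
          algebraMap ℚ (PadicAlgCl 2) (ratPlusSymbol f ((r + j) / q * ((∏ v : S₀, Rat.HeightOneSpectrum.natGenerator (v : IsDedekindDomain.HeightOneSpectrum (NumberField.RingOfIntegers ℚ)) ^ (k v) : ℕ) : ℚ)))) +
      (if q ∣ N then 0 else (q : PadicAlgCl 2)) * (q : PadicAlgCl 2)⁻¹ *
        ∑ k ∈ Fintype.piFinset (fun _ : S₀ ↦ Finset.range 3),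
          (∏ v : S₀, (1 - C ((W.LFunction (Rat.HeightOneSpectrum.natGenerator (v : IsDedekindDomain.HeightOneSpectrum (NumberField.RingOfIntegers ℚ))) : PadicAlgCl 2)) * X + (if Rat.HeightOneSpectrum.natGenerator (v : IsDedekindDomain.HeightOneSpectrum (NumberField.RingOfIntegers ℚ)) ∣ N then 0 else C (Rat.HeightOneSpectrum.natGenerator (v : IsDedekindDomain.HeightOneSpectrum (NumberField.RingOfIntegers ℚ)) : PadicAlgCl 2)) * X ^ 2 : (PadicAlgCl 2)[X]).coeff (k v) *
              ((Rat.HeightOneSpectrum.natGenerator (v : IsDedekindDomain.HeightOneSpectrum (NumberField.RingOfIntegers ℚ)) : PadicAlgCl 2)⁻¹) ^ (k v)) *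
            algebraMap ℚ (PadicAlgCl 2) (ratPlusSymbol f ((q : ℚ) * r * ((∏ v : S₀, Rat.HeightOneSpectrum.natGenerator (v : IsDedekindDomain.HeightOneSpectrum (NumberField.RingOfIntegers ℚ)) ^ (k v) : ℕ) : ℚ))) := by
  obtain ⟨ι, hι, ha⟩ := exists_embedding_of_isNewformOf hf
  have h := heckeT_depletedPartnerSymbol ι hf.1 (isPlusPeriod_plusPeriod hf.1 hf.coeffField_eq_bot) S₀ hq hqS r
  simp only [hι, ha] at h
  exact h

/-- **`U_ℓ φ^{S₀}_W = 0` for `ℓ = ℓ_{v₀}`, `v₀ ∈ S₀`**: the `S₀`-depleted rational plus symbol of the newform of `W` is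
killed by `U_ℓ` at every place of `S₀`: `∑_{j<ℓ} φ^{S₀}_W((r+j)/ℓ) = 0`.
[cite: GreenbergVatsal2000, §1 (8) and §3 (U_ℓ acts by 0 on the Σ₀-depleted form)] -/
theorem heckeU_depletedCurveSymbol_eq_zero {W : WeierstrassCurve ℚ} (hf : IsNewformOf W f)
    (S₀ : Finset (IsDedekindDomain.HeightOneSpectrum (NumberField.RingOfIntegers ℚ)))
    {v₀ : IsDedekindDomain.HeightOneSpectrum (NumberField.RingOfIntegers ℚ)} (hv₀ : v₀ ∈ S₀) (r : ℚ) :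
    ∑ j : Fin (Rat.HeightOneSpectrum.natGenerator v₀), ∑ k ∈ Fintype.piFinset (fun _ : S₀ ↦ Finset.range 3),
        (∏ v : S₀, (1 - C ((W.LFunction (Rat.HeightOneSpectrum.natGenerator (v : IsDedekindDomain.HeightOneSpectrum (NumberField.RingOfIntegers ℚ))) : PadicAlgCl 2)) * X + (if Rat.HeightOneSpectrum.natGenerator (v : IsDedekindDomain.HeightOneSpectrum (NumberField.RingOfIntegers ℚ)) ∣ N then 0 else C (Rat.HeightOneSpectrum.natGenerator (v : IsDedekindDomain.HeightOneSpectrum (NumberField.RingOfIntegers ℚ)) : PadicAlgCl 2)) * X ^ 2 : (PadicAlgCl 2)[X]).coeff (k v) *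
            ((Rat.HeightOneSpectrum.natGenerator (v : IsDedekindDomain.HeightOneSpectrum (NumberField.RingOfIntegers ℚ)) : PadicAlgCl 2)⁻¹) ^ (k v)) *
          algebraMap ℚ (PadicAlgCl 2) (ratPlusSymbol f ((r + j) / (Rat.HeightOneSpectrum.natGenerator v₀) *
            ((∏ v : S₀, Rat.HeightOneSpectrum.natGenerator (v : IsDedekindDomain.HeightOneSpectrum (NumberField.RingOfIntegers ℚ)) ^ (k v) : ℕ) : ℚ))) = 0 := by
  obtain ⟨ι, hι, ha⟩ := exists_embedding_of_isNewformOf hf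
  have h := heckeU_depletedPartnerSymbol_eq_zero ι hf.1 (isPlusPeriod_plusPeriod hf.1 hf.coeffField_eq_bot) S₀ hv₀ r
  simp only [hι, ha] at h
  exact h

end Curve

end Summit.BirchSwinnertonDyer.BirchSwinnertonDyer.Theorems.ThetaLayerLambdaCongruenceAtTwo

end
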